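import Mathlib
import Literature.Probability.Moments.HoeffdingCounting
import HarnessLib

/-!
# Crux `MobiusLadder.LiouvilleOrthogonalTC0` (stmt-QuantumAdvantage-1393), line `Sketch`, skeleton v6:
# stub `stub_cubeTail` — the Hoeffding count on the cube

For every orientation `o : Fin m → Bool` and `t ≥ 0`,
`#{σ ∈ {0,1}^m : t ≤ Σ_j x_j(σ)} ≤ 2^m · e^{-t²/(2m)}`, where `x_j(σ) = +1` if `σ_j = o_j` and `-1`
otherwise. This is the one-sided Hoeffding inequality in counting form
(`Literature.Probability.Moments.hoeffding_count_pi`, Hoeffding 1963 Thm. 2) for the mean-zero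
summands `f_j(b) = ±1` on `κ_j = Bool`, `c_j = 1`, `Σ_j c_j² = m`; the degenerate cube `m = 0` is
checked by hand (`#{σ} ≤ 1 = 2⁰ e⁰`, Lean's `t²/0 = 0`).

Used by Kane's argument (`stub_levelOne`, `stub_kaneSens`: D. M. Kane, *The average sensitivity of
an intersection of half spaces*, STOC 2014, Lemma 6) in the depth-two `∧/∨`-top rung of the line.
-/

set_option linter.dupNamespace false -- D-0017: single-problem summit ⇒ `QuantumAdvantage.QuantumAdvantage` by design

noncomputable section

namespace Summit.QuantumAdvantage.QuantumAdvantage.Theorems.LiouvilleOrthogonalTC0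

open Finset

namespace StubCubeTail

/-- The signed coordinate `x_j(σ) ∈ {±1}` has mean zero over `Bool`. -/
theorem sum_bool_sign (b : Bool) : ∑ a : Bool, (if a = b then (1 : ℝ) else -1) = 0 := by
  cases b <;> simp

/-- The signed coordinate is bounded by `1` in absolute value. -/
theorem abs_sign_le (a b : Bool) : |(if a = b then (1 : ℝ) else -1)| ≤ 1 := by
  split_ifs <;> simp

end StubCubeTail

open StubCubeTail in
/-- **Stub `stub_cubeTail` (line `Sketch`, v6) — the Hoeffding count on the cube.** For every
orientation `o` and `t ≥ 0`, `#{σ ∈ {0,1}^m : t ≤ Σ_j x_j(σ)} ≤ 2^m e^{-t²/(2m)}` where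
`x_j(σ) = ±1` according as `σ_j = o_j` or not (Hoeffding 1963, Thm. 2, counting form
`hoeffding_count_pi` with `κ_j = Bool`, `c_j = 1`). -/
theorem stub_cubeTail (m : ℕ) (o : Fin m → Bool) (t : ℝ) (ht : 0 ≤ t) :
    (((univ : Finset (Fin m → Bool)).filter fun σ =>
        t ≤ ∑ j : Fin m, (if σ j = o j then (1 : ℝ) else -1)).card : ℝ)
      ≤ 2 ^ m * Real.exp (-(t ^ 2 / (2 * m))) := by
  rcases Nat.eq_zero_or_pos m with rfl | hm
  · -- the degenerate cube: at most one point, and `2⁰ e^{-(t²/0)} = 1`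
    have hcard : (((univ : Finset (Fin 0 → Bool)).filter fun σ =>
        t ≤ ∑ j : Fin 0, (if σ j = o j then (1 : ℝ) else -1)).card : ℝ) ≤ 1 := by
      have h := Finset.card_filter_le (univ : Finset (Fin 0 → Bool))
        (fun σ => t ≤ ∑ j : Fin 0, (if σ j = o j then (1 : ℝ) else -1))
      have hu : (univ : Finset (Fin 0 → Bool)).card = 1 := by simp
      exact_mod_cast h.trans hu.le
    simpa using hcard
  · have h := Literature.Probability.Moments.hoeffding_count_pi
      (κ := fun _ : Fin m => Bool)
      (fun j (a : Bool) => (if a = o j then (1 : ℝ) else -1)) (fun _ => (1 : ℝ))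
      (fun j => sum_bool_sign (o j)) (fun j a => abs_sign_le a (o j)) ht
      (by simp only [one_pow, sum_const, card_univ, Fintype.card_fin, nsmul_eq_mul, mul_one]
          exact_mod_cast hm)
    simp only [one_pow, sum_const, card_univ, Fintype.card_fin, nsmul_eq_mul, mul_one,
      Fintype.card_bool, Nat.cast_ofNat, prod_const] at h
    rw [mul_comm] at h
    exact h

end Summit.QuantumAdvantage.QuantumAdvantage.Theorems.LiouvilleOrthogonalTC0

end
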